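import Summits.Ventures.LatticeQCDFlow.Scaling.MeanActionTransport
import Summits.Ventures.LatticeQCDFlow.Scaling.LatticeEntropyGrowthSharp
import Summits.Ventures.LatticeQCDFlow.Scaling.LatticeEntropyU1
import Summits.Ventures.LatticeQCDFlow.Scaling.LatticeEntropyUN
import Summits.Ventures.LatticeQCDFlow.Scaling.LatticeEntropySUNLaw

/-!
# LatticeQCDFlow / Scaling — MEAN-ACTION TRANSPORT LAWS for `U(1)`, `U(N)`, `SU(N)` with no hypothesis left

HONEST FRAMING: exact (Metropolis-corrected) sampling algorithms for lattice gauge theory; figures of merit are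
autocorrelation/cost numbers at stated couplings and volumes; no continuum-physics claim.

Venture `LatticeQCDFlow` (cell pub-lqcd), topic `Scaling`, FANOUT row 29 (theory-2) — OUR WORK (THEORY-2.md §3.3
v2.9).  The mean-action transport laws of `Scaling/MeanActionTransport.lean` — (C2a-CΔ)
`MeanActionContractionBetween`, (C2a-C°Δ) `MeanActionContractionSharp`: the sharp co-Lipschitz lower bounds for
ARBITRARY measurable co-Lipschitz maps, paid in `log coLip` or in mean action — discharged from the tree's two-sided
Haar ball volumes (`Scaling/CircleBallVolume.lean`, `ExactTransportUN.lean`, `ExactTransportSUN.lean`) and the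
unconditional entropy-growth laws (`U1.u1EntropyGrowth`, `UN.entropyGrowthLaw`, `SUN.entropyGrowthLaw`):

* `U(1) = Circle`, `κ = 1`, `d ≥ 1`:  `U1.meanActionContractionBetween`;
* `U(N)`, `N ≥ 1`, `κ = N²`, Hilbert–Schmidt metric, `d ≥ 1`:  `UN.meanActionContractionBetween`;
* `SU(N)`, `N ≥ 2`, `κ = N² - 1`, Hilbert–Schmidt metric, `d ≥ 1`:  `SUN.meanActionContractionBetween`,
  `SUN.meanActionContractionSharp`.

For `SU(3)`, `d = 4`, uniformly in `L ≥ 2` and `1 ≤ β₀ ≤ β`: EVERY measurable `K'`-co-Lipschitz map `T` of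
`SU(3)^E` satisfies `log K' + β·Δ_T/(32·L^4) ≥ (3/8)(1 - O(1/L))·log β - (3/8 + O(L^{-4}))·log β₀ - C`, where
`Δ_T = E_{T_*μ_{Λ,β₀}} S - ⟨S⟩_{Λ,β}` is the mean-action excess of the model over the target: either the flow
contracts at the exact-transport rate, or its model is hotter than `μ_{Λ,β}` by an extensive amount of action.
Elementary given the tree; nothing here is cited as a fact.
-/

noncomputable section

namespace Summit.Ventures.LatticeQCDFlow.Theory2.Lattice

open MeasureTheory InformationTheory Metric Set Literature.MathematicalPhysics.QuantumFieldTheory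

/-! ## §3. Instances with no hypothesis left: `U(1)`, `U(N)`, `SU(N)` -/

section Instances

open scoped Matrix.Norms.Frobenius
open Literature.MathematicalPhysics.QuantumFieldTheory.UnitaryCayley (𝔾)
open Literature.MathematicalPhysics.QuantumLattice (u1Rep continuous_u1Rep unitaryFundamentalRep
  continuous_unitaryFundamentalRep fundamentalRep continuous_fundamentalRep)

/-- **(C2a-CΔ) for `U(1) = Circle`**, `d ≥ 1`, `κ = 1` (OURS). [folklore] -/
theorem U1.meanActionContractionBetween (d : ℕ) (hd : 1 ≤ d) :
    MeanActionContractionBetween d 1 Circle u1Rep 1 := by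
  obtain ⟨a, ha, hlo⟩ := U1.haar_closedBall_ge'
  obtain ⟨A, _, hup⟩ := U1.haar_closedBall_le'
  obtain ⟨C, hC⟩ := U1.u1EntropyGrowth d
  have h := meanActionContractionBetween_of_ballVolumes u1Rep d hd continuous_u1Rep U1.re_trace_u1Rep_le
    one_pos ha hlo hup
    ⟨C, fun L _ hL β hβ => by simpa only [Nat.cast_one, one_mul] using hC L hL β hβ⟩
  simpa only [Nat.cast_one] using h

/-- **(C2a-CΔ) for `U(N)`**, `N ≥ 1`, `d ≥ 1`, `κ = N²`, Hilbert–Schmidt metric (OURS). [folklore] -/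
theorem UN.meanActionContractionBetween (d N : ℕ) (hd : 1 ≤ d) (hN : 1 ≤ N) :
    @MeanActionContractionBetween d N (𝔾 N) _ Subtype.metricSpace UN.isTopologicalGroup_hs UN.compactSpace_hs _
      UN.borelSpace_hs (unitaryFundamentalRep (Fin N) ℂ) ((N : ℝ) ^ 2) := by
  obtain ⟨a, ha, hlo⟩ := UN.haar_closedBall_ge (N := N)
  obtain ⟨A, hA, hup⟩ := UN.haar_closedBall_le (N := N)
  have hκ : 0 < N * N := Nat.mul_pos (by omega) (by omega)
  have hcast : ((N * N : ℕ) : ℝ) = (N : ℝ) ^ 2 := by push_cast; ring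
  obtain ⟨C, hC⟩ := UN.entropyGrowthLaw d N
  have h := @meanActionContractionBetween_of_ballVolumes N (𝔾 N) _ Subtype.metricSpace UN.isTopologicalGroup_hs
    UN.compactSpace_hs UN.secondCountable_hs _ UN.borelSpace_hs (unitaryFundamentalRep (Fin N) ℂ) d hd
    (continuous_unitaryFundamentalRep (Fin N) ℂ) UN.re_trace_le (N * N) hκ a A ha hlo
    (fun g r hr => hup g r hr) ⟨C, fun L _ hL β hβ => by rw [hcast]; exact hC L hL β hβ⟩
  rwa [hcast] at h

/-- **(C2a-CΔ) for `SU(N)`**, `N ≥ 2`, `d ≥ 1`, `κ = N² - 1`, Hilbert–Schmidt metric (OURS; `SU(3)`, `d = 4`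
included: EVERY measurable co-Lipschitz map `T`, `1 ≤ β₀ ≤ β`, has `log coLip(T) + β·Δ_T/(32 L^4) ≥
(3/8)(1 - O(1/L))·log β - (3/8 + O(L^{-4}))·log β₀ - C`, `Δ_T` the mean-action excess of `T_*μ_{Λ,β₀}` over
`μ_{Λ,β}`). [folklore] -/
theorem SUN.meanActionContractionBetween (d N : ℕ) (hd : 1 ≤ d) (hN : 2 ≤ N) :
    @MeanActionContractionBetween d N (Matrix.specialUnitaryGroup (Fin N) ℂ) _ Subtype.metricSpace
      SUN.isTopologicalGroup_hs SUN.compactSpace_hs _ SUN.borelSpace_hs (fundamentalRep (Fin N))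
      ((N : ℝ) ^ 2 - 1) := by
  haveI : NeZero N := ⟨by omega⟩
  obtain ⟨a, ha, hlo⟩ := SUN.haar_closedBall_ge (N := N)
  obtain ⟨A, hA, hup⟩ := SUN.haar_closedBall_le (N := N)
  have hNN : 1 ≤ N * N := le_trans (by omega : 1 ≤ N) (Nat.le_mul_self N)
  have hκ : 0 < N * N - 1 := by
    have : 2 * 2 ≤ N * N := Nat.mul_le_mul hN hN
    omega
  have hcast : ((N * N - 1 : ℕ) : ℝ) = (N : ℝ) ^ 2 - 1 := by
    rw [Nat.cast_sub hNN]; push_cast; ring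
  obtain ⟨C, hC⟩ := SUN.entropyGrowthLaw d N (by omega)
  have h := @meanActionContractionBetween_of_ballVolumes N (Matrix.specialUnitaryGroup (Fin N) ℂ) _
    Subtype.metricSpace SUN.isTopologicalGroup_hs SUN.compactSpace_hs SUN.secondCountable_hs _ SUN.borelSpace_hs
    (fundamentalRep (Fin N)) d hd (continuous_fundamentalRep (Fin N)) (SUN.re_trace_le N)
    (N * N - 1) hκ a A ha hlo (fun g r hr => hup g r hr) ⟨C, fun L _ hL β hβ => by rw [hcast]; exact hC L hL β hβ⟩
  rwa [hcast] at h

/-- **(C2a-C°Δ) for `SU(N)`**, `N ≥ 2`, `d ≥ 1`, `κ = N² - 1`, Hilbert–Schmidt metric (OURS; `SU(3)`, `d = 4`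
included: EVERY measurable co-Lipschitz map `T` of the prior has `log coLip(T) + β·Δ_T/(32 L^4) ≥
(3/8)(1 - O(1/L))·log β - C` for every `L ≥ 2`, `β ≥ 1`). [folklore] -/
theorem SUN.meanActionContractionSharp (d N : ℕ) (hd : 1 ≤ d) (hN : 2 ≤ N) :
    @MeanActionContractionSharp d N (Matrix.specialUnitaryGroup (Fin N) ℂ) _ Subtype.metricSpace
      SUN.isTopologicalGroup_hs SUN.compactSpace_hs _ SUN.borelSpace_hs (fundamentalRep (Fin N))
      ((N : ℝ) ^ 2 - 1) := by
  haveI : NeZero N := ⟨by omega⟩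
  obtain ⟨a, ha, hlo⟩ := SUN.haar_closedBall_ge (N := N)
  obtain ⟨A, hA, hup⟩ := SUN.haar_closedBall_le (N := N)
  have hNN : 1 ≤ N * N := le_trans (by omega : 1 ≤ N) (Nat.le_mul_self N)
  have hκ : 0 < N * N - 1 := by
    have : 2 * 2 ≤ N * N := Nat.mul_le_mul hN hN
    omega
  have hcast : ((N * N - 1 : ℕ) : ℝ) = (N : ℝ) ^ 2 - 1 := by
    rw [Nat.cast_sub hNN]; push_cast; ring
  obtain ⟨C, hC⟩ := SUN.entropyGrowthLaw d N (by omega)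
  have h := @meanActionContractionSharp_of_ballVolumes N (Matrix.specialUnitaryGroup (Fin N) ℂ) _
    Subtype.metricSpace SUN.isTopologicalGroup_hs SUN.compactSpace_hs SUN.secondCountable_hs _ SUN.borelSpace_hs
    (fundamentalRep (Fin N)) d hd (continuous_fundamentalRep (Fin N)) (SUN.re_trace_le N)
    (N * N - 1) hκ a A ha hlo (fun g r hr => hup g r hr) ⟨C, fun L _ hL β hβ => by rw [hcast]; exact (hC L hL β hβ).1⟩
  rwa [hcast] at h

end Instances

end Summit.Ventures.LatticeQCDFlow.Theory2.Lattice
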